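import Mathlib
import Summits.Ventures.PercRepro2.Defs
import Summits.Ventures.PercRepro2.Harris
import Summits.Ventures.PercRepro2.TReduction
import Summits.Ventures.PercRepro2.THAntipodalCoef

/-!
# The antipodal-pair certificate for the three-event form (mine-a g49)

A lower bound `L_D(p)` that satisfies the pinning recursion and is below `K_D(a)` at the base
cases is a lower bound everywhere (`kform_ge_of_base`, the induction of
`TReduction.kform_nonneg_of_base`). Instantiating `L` with three terms — the main base case and an
*antipodal pair* of pinnings `a`, `ā` of a set `S` of edges (coefficients from `THAntipodalCoef`)
— and using `c_{E∖S,a} · c_{E∖S,ā} = c_E²` (hence `c_a + c_ā ≥ 2 c_E`, AM–GM) gives: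
**if every proper pinned base case is `≥ 0`, the main base case is `≥ −2κ` and the two antipodal
base cases are `≥ κ ≥ 0`, then the three-event form is `≥ 0` for every admissible weight vector**
(`tform_nonneg_of_antipodal_pair`). This is the certificate that proves `(T_h)` on the five
7-vertex classes (i)–(v) of MINE-A.md §104.3 modulo the (finite, exact) base-case values.
-/

namespace Summit.Ventures.PercRepro2

namespace THAntipodalPair

open Finset TReduction

section Admissible

variable {E : Type*} [Fintype E] [DecidableEq E] {R : Type*} [Field R] [LinearOrder R]
  [IsStrictOrderedRing R]

omit [Fintype E] [DecidableEq E] in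
/-- `pinA` is admissible. -/
lemma isProbVec_pinA (a : Config E) : IsProbVec (pinA a : E → R) :=
  ⟨fun x => by unfold pinA; split_ifs <;> norm_num, fun x => by unfold pinA; split_ifs <;> norm_num⟩

end Admissible

section Main

variable {E : Type*} [Fintype E] [DecidableEq E] {R : Type*} [Field R] [LinearOrder R]
  [IsStrictOrderedRing R]

/-- **The reduction theorem with a lower bound.** If `L` satisfies the pinning recursion as an
inequality (`L_D(p) ≤ (1−p g)² L_D(p[g↦0]) + (p g)² L_D(p[g↦1]) + p g (1−p g) L_{D∪g}(p)` for
every admissible `p` and `g ∉ D`) and `L_D(a) ≤ K_D(a)` at every base case, then `L_D(p) ≤ K_D(p)`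
for every admissible `p` (the induction of `TReduction.kform_nonneg_of_base`, which is the case
`L = 0`). -/
theorem kform_ge_of_base (Q U e : Set (Config E)) (L : Finset E → (E → R) → R)
    (hL : ∀ (D : Finset E) (p : E → R) (g : E), g ∉ D → IsProbVec p →
      L D p ≤ (1 - p g) ^ 2 * L D (Function.update p g 0) + p g ^ 2 * L D (Function.update p g 1)
        + p g * (1 - p g) * L (insert g D) p)
    (hbase : ∀ (D : Finset E) (a : E → R), IsProbVec a → (∀ x, x ∉ D → a x = 0 ∨ a x = 1) →
      L D a ≤ kform Q U e D a) :
    ∀ (D : Finset E) (p : E → R), IsProbVec p → L D p ≤ kform Q U e D p := by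
  suffices h : ∀ n : ℕ, ∀ (D : Finset E) (p : E → R), IsProbVec p → (freeEdges D p).card = n →
      L D p ≤ kform Q U e D p from fun D p hp => h _ D p hp rfl
  intro n
  induction n with
  | zero =>
    intro D p hp hn
    apply hbase D p hp
    intro x hx
    by_cases h0 : p x = 0
    · exact Or.inl h0
    by_cases h1 : p x = 1
    · exact Or.inr h1
    exfalso
    have hmem : x ∈ freeEdges D p := mem_freeEdges.2 ⟨hx, h0, h1⟩
    rw [card_eq_zero] at hn
    rw [hn] at hmem
    exact notMem_empty x hmem
  | succ n ih =>
    intro D p hp hn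
    obtain ⟨g, hg⟩ : (freeEdges D p).Nonempty := by
      rw [← card_pos, hn]; exact Nat.succ_pos n
    have hgD : g ∉ D := (mem_freeEdges.1 hg).1
    have hcard : ((freeEdges D p).erase g).card = n := by
      rw [card_erase_of_mem hg, hn]; rfl
    have h0 : L D (Function.update p g 0) ≤ kform Q U e D (Function.update p g 0) :=
      ih D _ (hp.update g le_rfl zero_le_one) (by rw [freeEdges_update D p hg (Or.inl rfl), hcard])
    have h1 : L D (Function.update p g 1) ≤ kform Q U e D (Function.update p g 1) :=
      ih D _ (hp.update g zero_le_one le_rfl) (by rw [freeEdges_update D p hg (Or.inr rfl), hcard])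
    have h2 : L (insert g D) p ≤ kform Q U e (insert g D) p :=
      ih (insert g D) p hp (by rw [freeEdges_insert D p g, hcard])
    rw [kform_pin Q U e hgD p]
    have hpg0 : 0 ≤ p g := hp.nonneg g
    have hpg1 : 0 ≤ 1 - p g := sub_nonneg.2 (hp.le_one g)
    refine le_trans (hL D p g hgD hp) ?_
    have e0 := mul_le_mul_of_nonneg_left h0 (sq_nonneg (1 - p g))
    have e1 := mul_le_mul_of_nonneg_left h1 (sq_nonneg (p g))
    have e2 := mul_le_mul_of_nonneg_left h2 (mul_nonneg hpg0 hpg1)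
    linarith

/-- The three-term lower bound: the main base case and an antipodal pair `a`, `ā` of pinnings
of the edge set `S`, each with its coefficient. -/
noncomputable def L3 (Q U e : Set (Config E)) (S : Finset E) (a : Config E) (D : Finset E) (p : E → R) : R :=
  coef D univ a p * kform Q U e univ (fun _ => (0 : R))
    + coef D (univ \ S) a p * kform Q U e (univ \ S) (pinA a)
    + coef D (univ \ S) (fun x => !a x) p * kform Q U e (univ \ S) (pinA fun x => !a x)

omit [LinearOrder R] [IsStrictOrderedRing R] in
/-- `L3` satisfies the pinning recursion (with equality). -/
lemma L3_pin (Q U e : Set (Config E)) (S : Finset E) (a : Config E) (D : Finset E) (p : E → R)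
    {g : E} (hg : g ∉ D) :
    L3 Q U e S a D p =
      (1 - p g) ^ 2 * L3 Q U e S a D (Function.update p g 0)
        + p g ^ 2 * L3 Q U e S a D (Function.update p g 1)
        + p g * (1 - p g) * L3 Q U e S a (insert g D) p := by
  unfold L3
  rw [coef_pin D univ a p hg, coef_pin D (univ \ S) a p hg, coef_pin D (univ \ S) (fun x => !a x) p hg]
  ring

omit [IsStrictOrderedRing R] in
/-- `L3` is below `K` at every base case, given: every proper base case is `≥ 0`. -/
lemma L3_base (Q U e : Set (Config E)) (S : Finset E) (hS : S.Nonempty) (a : Config E)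
    (hprop : ∀ (D : Finset E) (a₀ : E → R), IsProbVec a₀ → (∀ x, x ∉ D → a₀ x = 0 ∨ a₀ x = 1) →
      D ≠ univ → 0 ≤ kform Q U e D a₀)
    (D : Finset E) (a₀ : E → R) (ha₀ : IsProbVec a₀) (h01 : ∀ x, x ∉ D → a₀ x = 0 ∨ a₀ x = 1) :
    L3 Q U e S a D a₀ ≤ kform Q U e D a₀ := by
  have hSu : univ \ S ≠ univ := by
    intro h
    obtain ⟨x, hx⟩ := hS
    have : x ∈ univ \ S := by rw [h]; exact mem_univ x
    exact (mem_sdiff.1 this).2 hx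
  unfold L3
  by_cases hDu : D = univ
  · subst hDu
    have hv : ∀ x, x ∉ (univ : Finset E) → a₀ x = if a x then 1 else 0 :=
      fun x hx => absurd (mem_univ x) hx
    rw [coef_base_one univ a a₀ hv,
      coef_base_zero univ (univ \ S) a a₀ h01 (fun h => hSu h.1.symm),
      coef_base_zero univ (univ \ S) (fun x => !a x) a₀ h01 (fun h => hSu h.1.symm),
      kform_univ_const Q U e (fun _ => (0 : R)) a₀]
    simp
  · rw [coef_base_zero D univ a a₀ h01 (fun h => hDu h.1)]
    by_cases hm1 : D = univ \ S ∧ ∀ x, x ∉ D → a₀ x = if a x then 1 else 0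
    · have hm2 : ¬ (D = univ \ S ∧ ∀ x, x ∉ D → a₀ x = if (!a x) then 1 else 0) := by
        rintro ⟨-, h2⟩
        exact not_match_both S hS a a₀ (hm1.1 ▸ hm1.2) (hm1.1 ▸ h2)
      rw [coef_base_zero D (univ \ S) (fun x => !a x) a₀ h01 hm2, hm1.1,
        coef_base_one (univ \ S) a a₀ (hm1.1 ▸ hm1.2),
        kform_congr_off Q U e (univ \ S) (p := a₀) (q := pinA a) (hm1.1 ▸ hm1.2)]
      simp
    · rw [coef_base_zero D (univ \ S) a a₀ h01 hm1]
      by_cases hm2 : D = univ \ S ∧ ∀ x, x ∉ D → a₀ x = if (!a x) then 1 else 0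
      · rw [hm2.1, coef_base_one (univ \ S) (fun x => !a x) a₀ (hm2.1 ▸ hm2.2),
          kform_congr_off Q U e (univ \ S) (p := a₀) (q := pinA fun x => !a x) (hm2.1 ▸ hm2.2)]
        simp
      · rw [coef_base_zero D (univ \ S) (fun x => !a x) a₀ h01 hm2]
        simpa using hprop D a₀ ha₀ h01 hDu

omit [LinearOrder R] [IsStrictOrderedRing R] in
/-- `coef ∅ univ` is `c_E(p) = Π_e p_e (1 − p_e)`. -/
lemma coef_empty_univ (a : Config E) (p : E → R) :
    coef (∅ : Finset E) univ a p = ∏ e, p e * (1 - p e) := by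
  unfold coef
  rw [if_pos (empty_subset _), sdiff_empty, sdiff_self]
  simp

omit [LinearOrder R] [IsStrictOrderedRing R] in
/-- `coef ∅ (univ \ S)` is `Π_{e ∉ S} p_e (1 − p_e) · Π_{e ∈ S} (edgeFactor (p e) (a e))²`. -/
lemma coef_empty_sdiff (S : Finset E) (a : Config E) (p : E → R) :
    coef (∅ : Finset E) (univ \ S) a p =
      (∏ e ∈ univ \ S, p e * (1 - p e)) * ∏ e ∈ S, (edgeFactor (p e) (a e)) ^ 2 := by
  unfold coef
  rw [if_pos (empty_subset _), sdiff_empty, Finset.sdiff_sdiff_eq_self (subset_univ S)]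

omit [LinearOrder R] [IsStrictOrderedRing R] in
/-- The two Bernoulli factors of an edge multiply to `q (1 − q)`. -/
lemma edgeFactor_mul_edgeFactor_not (q : R) (b : Bool) :
    edgeFactor q b * edgeFactor q (!b) = q * (1 - q) := by
  cases b
  · show (1 - q) * q = q * (1 - q)
    ring
  · show q * (1 - q) = q * (1 - q)
    rfl

omit [LinearOrder R] [IsStrictOrderedRing R] in
/-- **The antipodal product identity**: `c_{E∖S,a}(p) · c_{E∖S,ā}(p) = c_E(p)²`. -/
theorem coef_antipodal_mul (S : Finset E) (a : Config E) (p : E → R) :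
    coef (∅ : Finset E) (univ \ S) a p * coef (∅ : Finset E) (univ \ S) (fun x => !a x) p =
      (coef (∅ : Finset E) univ a p) ^ 2 := by
  rw [coef_empty_sdiff, coef_empty_sdiff, coef_empty_univ, ← prod_sdiff (subset_univ S)]
  have h : (∏ e ∈ S, (edgeFactor (p e) (a e)) ^ 2) * (∏ e ∈ S, (edgeFactor (p e) (!a e)) ^ 2) =
      (∏ e ∈ S, p e * (1 - p e)) ^ 2 := by
    rw [← prod_mul_distrib, ← prod_pow]
    apply prod_congr rfl
    intro x _
    rw [← mul_pow, edgeFactor_mul_edgeFactor_not]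
  calc ((∏ e ∈ univ \ S, p e * (1 - p e)) * ∏ e ∈ S, (edgeFactor (p e) (a e)) ^ 2) *
        ((∏ e ∈ univ \ S, p e * (1 - p e)) * ∏ e ∈ S, (edgeFactor (p e) (!a e)) ^ 2)
      = (∏ e ∈ univ \ S, p e * (1 - p e)) ^ 2 *
          ((∏ e ∈ S, (edgeFactor (p e) (a e)) ^ 2) *
            (∏ e ∈ S, (edgeFactor (p e) (!a e)) ^ 2)) := by
        ring
    _ = _ := by rw [h]; ring

/-- The coefficients are nonnegative for admissible weights. -/
lemma coef_nonneg (D D' : Finset E) (a' : Config E) {p : E → R} (hp : IsProbVec p) :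
    0 ≤ coef D D' a' p := by
  unfold coef
  split_ifs
  · apply mul_nonneg
    · exact prod_nonneg fun x _ => mul_nonneg (hp.nonneg x) (sub_nonneg.2 (hp.le_one x))
    · exact prod_nonneg fun x _ => sq_nonneg _
  · exact le_refl 0

/-- AM–GM for a pair: `x y = z²` with `x, y, z ≥ 0` gives `2 z ≤ x + y`. -/
lemma two_mul_le_add_of_mul_eq_sq {x y z : R} (hx : 0 ≤ x) (hy : 0 ≤ y)
    (h : x * y = z ^ 2) : 2 * z ≤ x + y := by
  nlinarith [sq_nonneg (x - y), sq_nonneg (x + y - 2 * z), mul_nonneg hx hy]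

/-- **The antipodal-pair certificate.** Let `S` be a nonempty set of edges and `a` a pinning
pattern on `S` (its antipode flips every edge of `S`). If every proper pinned base case of the
three-event form is `≥ 0`, the main base case is `≥ −2κ` and the two antipodal base cases
`K_{E∖S}(a)`, `K_{E∖S}(ā)` are `≥ κ ≥ 0`, then for every admissible weight vector
`P(Q∩U) P(e) + P(Q∩e) P(U) ≤ P(Q∩U∩e) + P(Q) P(U∩e)`. -/
theorem tform_nonneg_of_antipodal_pair (Q U e : Set (Config E)) (S : Finset E) (hS : S.Nonempty)
    (a : Config E) (κ : R) (hκ : 0 ≤ κ)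
    (hprop : ∀ (D : Finset E) (a₀ : E → R), IsProbVec a₀ → (∀ x, x ∉ D → a₀ x = 0 ∨ a₀ x = 1) →
      D ≠ univ → 0 ≤ kform Q U e D a₀)
    (hmain : -(2 * κ) ≤ kform Q U e univ (fun _ => (0 : R)))
    (ha : κ ≤ kform Q U e (univ \ S) (pinA a))
    (hā : κ ≤ kform Q U e (univ \ S) (pinA fun x => !a x))
    (p : E → R) (hp : IsProbVec p) :
    prob p (Q ∩ U) * prob p e + prob p (Q ∩ e) * prob p U ≤
      prob p (Q ∩ U ∩ e) + prob p Q * prob p (U ∩ e) := by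
  have hge := kform_ge_of_base Q U e (L3 Q U e S a)
    (fun D p g hg hp => le_of_eq (L3_pin Q U e S a D p hg))
    (fun D a₀ ha₀ h01 => L3_base Q U e S hS a hprop D a₀ ha₀ h01) ∅ p hp
  rw [kform_empty] at hge
  unfold gform at hge
  suffices hL : 0 ≤ L3 Q U e S a ∅ p by linarith
  unfold L3
  set cE := coef (∅ : Finset E) univ a p with hcE
  set ca := coef (∅ : Finset E) (univ \ S) a p with hca
  set cā := coef (∅ : Finset E) (univ \ S) (fun x => !a x) p with hcā
  have h0 : 0 ≤ cE := coef_nonneg _ _ _ hp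
  have h1 : 0 ≤ ca := coef_nonneg _ _ _ hp
  have h2 : 0 ≤ cā := coef_nonneg _ _ _ hp
  have hprod : ca * cā = cE ^ 2 := coef_antipodal_mul S a p
  have hamgm : 2 * cE ≤ ca + cā := two_mul_le_add_of_mul_eq_sq h1 h2 hprod
  have e1 := mul_le_mul_of_nonneg_left ha h1
  have e2 := mul_le_mul_of_nonneg_left hā h2
  have e3 := mul_le_mul_of_nonneg_left hmain h0
  nlinarith

end Main


end THAntipodalPair

end Summit.Ventures.PercRepro2
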